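import Mathlib
import Summits.ValiantsHypothesis.ValiantsHypothesis.Theorems.BinomialElusiveBinomialCandidatePolarImmersiveAtInfinity
import Summits.ValiantsHypothesis.ValiantsHypothesis.Theorems.BinomialElusiveBinomialCandidateInfinityCommonZero

/-!
# Crux `BinomialElusive.BinomialCandidate` (stmt-ValiantsHypothesis-7392), line `registered`,
# skeleton v4 — stub `stub_infinityStepTwo`: the second peeling step at the place over `x = ∞`

The registered stub `stub_infinityStepTwo` of the crux
`Summit.ValiantsHypothesis.ValiantsHypothesis.Theses.BinomialElusive.BinomialCandidate`,
branch `2μ = -N b_τ`.  Data: a quadratic `Γ : ℂ^s → ℂ^m` (`totalDegree (Γ i) ≤ 2`), `N ≥ 1`,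
`a i < b i`, `b` injective, a formal Laurent solution `p` of `Γ_i(p) = t^{-N a_i} + t^{-N b_i}`
with least order `μ < 0` and pole direction `z = (p_j.coeff μ)_j ≠ 0`, an index `τ` with
`2μ = -N b_τ`, `B_i(z) = 0` for `i ≠ τ` (`B_i = homogeneousComponent 2 (Γ i)`), and some `i ≠ τ`
with `b_τ < 2 b_i`.  Claim: there is a second direction `z' ∉ ℂ z` and an index `i₁` with
`Σ_j z'_j ∂_jB_i(z) = 0` for all `i ∉ {τ, i₁}`.

Proof (lowest-order calculus in the chart at infinity, as in
`PolarImmersive.polar_immersive_no_solution`).  Pick `j₀` with `z_{j₀} ≠ 0` and normalise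
`Λ = z_{j₀}⁻¹ p_{j₀}` (no coefficients below `μ`, coefficient `1` at `μ`, so `Λ⁻¹` has none below
`-μ` and coefficient `1` there).  Put `q j = Λ⁻¹ p j`: then `p j = Λ q j`, `q j` has no pole,
`(q j)(0) = z j`, `q j₀ = z j₀` is constant, and `w j = q j - z j` has positive order.  Let
`o ≥ 1` be the least exponent that carries a nonzero coefficient of some `w j` or equals `-μ`, and
`v j = (w j).coeff o` (so `v j₀ = 0`).  Each `q j` is the jet `z j + v j t^o`, hence
(`PolarImmersive.jet_aeval`) `B_i(q)` is the jet `B_i(z) + (Σ_j v_j ∂_jB_i(z)) t^o`, and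
splitting `Γ_i = K_i + L_i + B_i` into homogeneous pieces,
`Γ_i(p) = K_i + Λ L_i(q) + Λ² B_i(q)` (`InfinityStepTwo.coeff_aeval_of_jet`): for `i ≠ τ` it has
no coefficients below `2μ + o ≤ μ`, and if `o < -μ` its coefficient there is `Σ_j v_j ∂_jB_i(z)`.
Comparing with the target `t^{-N a_i} + t^{-N b_i}` (`InfinityCommonZero.le_and_eq_zero_or_eq`):

* if `o = -μ`, then `μ ≤ -N b_i`, i.e. `2 b_i ≤ b_τ`, for every `i ≠ τ` — contradicting the
  last hypothesis;
* if `o < -μ`, then `v ≠ 0` while `v j₀ = 0 ≠ z j₀`, so `v ∉ ℂ z`, and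
  `Σ_j v_j ∂_jB_i(z) ≠ 0` forces `2μ + o = -N b_i`, which by injectivity of `b` happens for at
  most one index `i₁`.

Mathlib only, plus the tree files imported above (`PolarPeeling.*`, `PolarImmersive.*`,
`AffinePeeling.*`, `InfinityCommonZero.*`).
-/

-- layout Summits/ValiantsHypothesis/ValiantsHypothesis forces the duplicated namespace component
set_option linter.dupNamespace false

namespace Summit.ValiantsHypothesis.ValiantsHypothesis.Theorems.BinomialCandidateStubs

open scoped BigOperators

namespace InfinityStepTwo

/-- **Orders after the first peeling step at infinity.**  Let `0 < o ≤ -μ`, let `Λ` have no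
coefficients below `μ` and coefficient `1` at `μ`, let every `q j` be the jet `z j + v j t^o`, and
let `Γ` (`totalDegree ≤ 2`) have quadratic part `B` with `B(z) = 0`.  Then
`Γ(Λ q) = K + Λ L(q) + Λ² B(q)` has no coefficients below `2μ + o`, and if `o < -μ` its
coefficient at `2μ + o` is `Σ_j v_j ∂_jB(z)` (the `t^o`-coefficient of the jet `B(q)`). -/
theorem coeff_aeval_of_jet {k : ℕ} {o μ : ℤ} (ho : 0 < o) (hoμ : o ≤ -μ) (Λ : LaurentSeries ℂ)
    (hΛ : ∀ g < μ, Λ.coeff g = 0) (hΛμ : Λ.coeff μ = 1)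
    (q : Fin k → LaurentSeries ℂ) (z v : Fin k → ℂ)
    (hq : ∀ j, ∀ g ≤ o, (q j).coeff g = (if g = 0 then z j else 0) + if g = o then v j else 0)
    (Γ : MvPolynomial (Fin k) ℂ) (hΓ : Γ.totalDegree ≤ 2)
    (hB : MvPolynomial.eval z (MvPolynomial.homogeneousComponent 2 Γ) = 0) :
    (∀ g < μ + μ + o, (MvPolynomial.aeval (fun j => Λ * q j) Γ).coeff g = 0) ∧
      (o < -μ → (MvPolynomial.aeval (fun j => Λ * q j) Γ).coeff (μ + μ + o) =
        ∑ j, v j * MvPolynomial.eval z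
          (MvPolynomial.pderiv j (MvPolynomial.homogeneousComponent 2 Γ))) := by
  set K := MvPolynomial.homogeneousComponent 0 Γ
  set L := MvPolynomial.homogeneousComponent 1 Γ
  set B := MvPolynomial.homogeneousComponent 2 Γ
  -- the identity `Γ(Λ q) = K(q) + Λ L(q) + Λ² B(q)`
  have e : ∀ n, MvPolynomial.aeval (fun j => Λ * q j) (MvPolynomial.homogeneousComponent n Γ) =
      Λ ^ n * MvPolynomial.aeval q (MvPolynomial.homogeneousComponent n Γ) := fun n =>
    PolarImmersive.aeval_mul_of_isHomogeneous _
      (MvPolynomial.homogeneousComponent_isHomogeneous n Γ) Λ q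
  have hT : MvPolynomial.aeval (fun j => Λ * q j) Γ =
      MvPolynomial.aeval q K + Λ * MvPolynomial.aeval q L + Λ * Λ * MvPolynomial.aeval q B := by
    conv_lhs => rw [PolarImmersive.eq_add_homogeneousComponent Γ hΓ, map_add, map_add, e 0, e 1,
      e 2]
    ring
  -- the pieces in the chart: `K(q)`, `L(q)` have no pole, `B(q)` is the jet `0 + (Σ v ∂B(z)) t^o`
  have hK0 : ∀ g < 0, (MvPolynomial.aeval q K).coeff g = 0 := fun g hg => by
    rw [PolarImmersive.jet_aeval ho hq K g (by omega), if_neg hg.ne, if_neg (by omega), add_zero]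
  have hL0 : ∀ g < 0, (MvPolynomial.aeval q L).coeff g = 0 := fun g hg => by
    rw [PolarImmersive.jet_aeval ho hq L g (by omega), if_neg hg.ne, if_neg (by omega), add_zero]
  have hB0 : ∀ g < o, (MvPolynomial.aeval q B).coeff g = 0 := fun g hg => by
    rw [PolarImmersive.jet_aeval ho hq B g hg.le, if_neg hg.ne, add_zero]
    split_ifs
    · exact hB
    · rfl
  have hBo : (MvPolynomial.aeval q B).coeff o =
      ∑ j, v j * MvPolynomial.eval z (MvPolynomial.pderiv j B) := by
    rw [PolarImmersive.jet_aeval ho hq B o le_rfl, if_neg ho.ne', if_pos rfl, zero_add]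
  have hΛΛ : ∀ g < μ + μ, (Λ * Λ).coeff g = 0 := PolarPeeling.coeff_mul_eq_zero_of_lt hΛ hΛ
  have hΛΛμ : (Λ * Λ).coeff (μ + μ) = 1 := by
    rw [PolarPeeling.coeff_mul_eq hΛ hΛ, hΛμ, mul_one]
  refine ⟨fun g hg => ?_, fun hlt => ?_⟩
  · rw [hT, HahnSeries.coeff_add, HahnSeries.coeff_add, hK0 g (by omega),
      PolarPeeling.coeff_mul_eq_zero_of_lt hΛ hL0 g (by omega),
      PolarPeeling.coeff_mul_eq_zero_of_lt hΛΛ hB0 g hg, add_zero, add_zero]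
  · rw [hT, HahnSeries.coeff_add, HahnSeries.coeff_add, hK0 _ (by omega),
      PolarPeeling.coeff_mul_eq_zero_of_lt hΛ hL0 _ (by omega),
      PolarPeeling.coeff_mul_eq hΛΛ hB0, hΛΛμ, hBo, one_mul, zero_add, zero_add]

end InfinityStepTwo

open InfinityStepTwo in
/-- **Stub `stub_infinityStepTwo`** (crux stmt-ValiantsHypothesis-7392, line `registered`,
skeleton v4): the second peeling step at the place over `x = ∞` in the branch `2μ = -N b_τ`.
Given a formal Laurent solution `p` of `Γ_i(p) = t^{-N a_i} + t^{-N b_i}` (`Γ` quadratic, `N ≥ 1`,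
`a_i < b_i`, `b` injective) with least order `μ < 0`, pole direction `z = (p_j.coeff μ)_j ≠ 0`,
`2μ = -N b_τ`, `B_i(z) = 0` for `i ≠ τ` and some `i ≠ τ` with `b_τ < 2 b_i`, there are a second
direction `z' ∉ ℂ z` and an index `i₁` such that the polar forms `Σ_j z'_j ∂_jB_i(z)` vanish for
all `i ∉ {τ, i₁}` (`B_i = homogeneousComponent 2 (Γ i)`). -/
theorem stub_infinityStepTwo :
    ∀ (m s : ℕ) (a b : Fin m → ℕ) (Γ : Fin m → MvPolynomial (Fin s) ℂ) (N : ℕ) (p : Fin s → LaurentSeries ℂ)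
      (μ : ℤ) (τ : Fin m),
      (∀ i, (Γ i).totalDegree ≤ 2) → 0 < N → (∀ i, a i < b i) → Function.Injective b →
      (∀ i, MvPolynomial.aeval p (Γ i) =
        HahnSeries.single (-((N * a i : ℕ) : ℤ)) (1 : ℂ) + HahnSeries.single (-((N * b i : ℕ) : ℤ)) (1 : ℂ)) →
      μ < 0 → (∀ j, ∀ g < μ, (p j).coeff g = 0) → (fun j => (p j).coeff μ) ≠ 0 →
      2 * μ = -((N * b τ : ℕ) : ℤ) →
      (∀ i, i ≠ τ → MvPolynomial.eval (fun j => (p j).coeff μ) (MvPolynomial.homogeneousComponent 2 (Γ i)) = 0) →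
      (∃ i, i ≠ τ ∧ b τ < 2 * b i) →
      ∃ z' : Fin s → ℂ, (∀ c : ℂ, z' ≠ c • (fun j => (p j).coeff μ)) ∧ ∃ i₁ : Fin m, ∀ i, i ≠ τ → i ≠ i₁ →
        ∑ j, z' j * MvPolynomial.eval (fun l => (p l).coeff μ)
          (MvPolynomial.pderiv j (MvPolynomial.homogeneousComponent 2 (Γ i))) = 0 := by
  intro m s a b Γ N p μ τ hΓ hN hab hb hsol hμ hp hz hτ hBz hex
  classical
  -- the exponents of the target: `-N b_i < -N a_i`
  have huv : ∀ i, -((N * b i : ℕ) : ℤ) < -((N * a i : ℕ) : ℤ) := fun i =>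
    neg_lt_neg (by exact_mod_cast Nat.mul_lt_mul_of_pos_left (hab i) hN)
  -- the pole direction `z` and a coordinate `j₀` with `z j₀ ≠ 0`
  set z : Fin s → ℂ := fun j => (p j).coeff μ
  obtain ⟨j₀, hj₀⟩ : ∃ j₀, z j₀ ≠ 0 := Function.ne_iff.mp hz
  -- `Λ = z_{j₀}⁻¹ p_{j₀}`: no coefficients below `μ`, coefficient `1` at `μ`, order `μ`
  set Λ : LaurentSeries ℂ := (z j₀)⁻¹ • p j₀ with hΛdef
  have hΛcoeff : ∀ g, Λ.coeff g = (z j₀)⁻¹ * (p j₀).coeff g := fun g => by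
    rw [hΛdef, HahnSeries.coeff_smul, smul_eq_mul]
  have hΛvan : ∀ g < μ, Λ.coeff g = 0 := fun g hg => by
    rw [hΛcoeff, hp j₀ g hg, mul_zero]
  have hΛμ : Λ.coeff μ = 1 := by
    rw [hΛcoeff]
    exact inv_mul_cancel₀ hj₀
  have hΛne : Λ ≠ 0 := by
    intro h
    have h1 := hΛμ
    rw [h, HahnSeries.coeff_zero] at h1
    exact zero_ne_one h1
  have hΛord : Λ.order = μ := by
    refine le_antisymm (HahnSeries.order_le_of_coeff_ne_zero (by rw [hΛμ]; exact one_ne_zero)) ?_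
    by_contra h
    exact (HahnSeries.coeff_order_eq_zero.not.mpr hΛne) (hΛvan _ (not_le.mp h))
  -- `Λ⁻¹`: no coefficients below `-μ`, coefficient `1` at `-μ`
  have hw₀Λ : Λ⁻¹ * Λ = 1 := inv_mul_cancel₀ hΛne
  have hw₀ord : Λ⁻¹.order = -μ := by
    have h := HahnSeries.order_mul (inv_ne_zero hΛne) hΛne
    rw [hw₀Λ, HahnSeries.order_one, hΛord] at h
    omega
  have hw₀van : ∀ g < -μ, Λ⁻¹.coeff g = 0 := fun g hg =>
    HahnSeries.coeff_eq_zero_of_lt_order (by rwa [hw₀ord])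
  have hw₀lead : Λ⁻¹.coeff (-μ) = 1 := by
    have h := PolarPeeling.coeff_mul_eq hw₀van hΛvan
    rw [hw₀Λ, neg_add_cancel, HahnSeries.coeff_one, if_pos rfl, hΛμ, mul_one] at h
    exact h.symm
  -- the chart at infinity: `q j = Λ⁻¹ p j`, `p j = Λ q j`, `(q j)(0) = z j`, `q j₀ = z j₀`
  set q : Fin s → LaurentSeries ℂ := fun j => Λ⁻¹ * p j with hqdef
  have hpq : p = fun j => Λ * q j := by
    funext j
    simp only [hqdef]
    rw [← mul_assoc, mul_inv_cancel₀ hΛne, one_mul]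
  have hqvan : ∀ j, ∀ g < 0, (q j).coeff g = 0 := fun j g hg =>
    PolarPeeling.coeff_mul_eq_zero_of_lt hw₀van (hp j) g (by omega)
  have hq0 : ∀ j, (q j).coeff 0 = z j := fun j => by
    have h := PolarPeeling.coeff_mul_eq hw₀van (hp j)
    rw [neg_add_cancel, hw₀lead, one_mul] at h
    exact h
  have hqj₀ : q j₀ = HahnSeries.C (z j₀) := by
    have h1 : p j₀ = HahnSeries.C (z j₀) * Λ := by
      rw [HahnSeries.C_mul_eq_smul, hΛdef, smul_inv_smul₀ hj₀]
    show Λ⁻¹ * p j₀ = _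
    rw [h1, mul_left_comm, hw₀Λ, mul_one]
  -- the local coordinates `w j = q j - z j` of positive order, `w j₀ = 0`
  set w : Fin s → LaurentSeries ℂ := fun j => q j - HahnSeries.C (z j) with hwdef
  have hwvan : ∀ j, ∀ g < 1, (w j).coeff g = 0 := by
    intro j g hg
    simp only [hwdef, HahnSeries.coeff_sub, HahnSeries.C_apply, HahnSeries.coeff_single]
    rcases lt_or_eq_of_le (show g ≤ 0 by omega) with hg | rfl
    · rw [hqvan j g hg, if_neg hg.ne, sub_zero]
    · rw [if_pos rfl, hq0, sub_self]
  have hw₀ : w j₀ = 0 := by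
    simp only [hwdef, hqj₀, sub_self]
  -- `o ≥ 1`: the least exponent carrying a nonzero coefficient of some `w j`, capped at `-μ`
  obtain ⟨o, hoP, homin⟩ := Int.exists_least_of_bdd
    (P := fun g => (∃ j, (w j).coeff g ≠ 0) ∨ g = -μ)
    ⟨1, fun g hg => by
      by_contra h
      rcases hg with ⟨j, hj⟩ | hg
      · exact hj (hwvan j g (by omega))
      · omega⟩
    ⟨-μ, Or.inr rfl⟩
  have ho : 0 < o := by
    by_contra h
    rcases hoP with ⟨j, hj⟩ | hg
    · exact hj (hwvan j o (by omega))
    · omega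
  have hoμ : o ≤ -μ := homin _ (Or.inr rfl)
  have hbelow : ∀ j, ∀ g < o, (w j).coeff g = 0 := fun j g hg => by
    by_contra h
    exact absurd (homin g (Or.inl ⟨j, h⟩)) (not_le.mpr hg)
  -- the jets `q j = z j + v j t^o`, `v j = (w j).coeff o`
  have hjq : ∀ j, ∀ g ≤ o, (q j).coeff g =
      (if g = 0 then z j else 0) + if g = o then (w j).coeff o else 0 := fun j => by
    refine PolarImmersive.jet_congr (PolarImmersive.jet_add (PolarImmersive.jet_C o (z j))
      (PolarImmersive.jet_of_coeff_eq_zero (hbelow j))) ?_ (add_zero _) (zero_add _)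
    simp only [hwdef]
    ring
  -- the outputs in the chart and their lowest orders
  have hsol' : ∀ i, MvPolynomial.aeval (fun j => Λ * q j) (Γ i) =
      HahnSeries.single (-((N * a i : ℕ) : ℤ)) (1 : ℂ) +
        HahnSeries.single (-((N * b i : ℕ) : ℤ)) (1 : ℂ) := by
    intro i
    have h := hsol i
    rw [hpq] at h
    exact h
  have key := fun i (hi : i ≠ τ) => coeff_aeval_of_jet ho hoμ Λ hΛvan hΛμ q z
    (fun j => (w j).coeff o) hjq (Γ i) (hΓ i) (hBz i hi)
  rcases hoμ.lt_or_eq with hlt | heq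
  · -- `o < -μ`: the direction `v` and at most one exceptional index
    have hcmp : ∀ i, i ≠ τ →
        (∑ j, (w j).coeff o * MvPolynomial.eval z
          (MvPolynomial.pderiv j (MvPolynomial.homogeneousComponent 2 (Γ i))) = 0 ∨
          μ + μ + o = -((N * b i : ℕ) : ℤ)) := fun i hi =>
      (InfinityCommonZero.le_and_eq_zero_or_eq (huv i) (hsol' i) (key i hi).1
        ((key i hi).2 hlt)).2
    have hv : ∀ c : ℂ, (fun j => (w j).coeff o) ≠ c • z := by
      intro c hc
      rcases hoP with ⟨j, hj⟩ | hg
      · have hc₀ := congr_fun hc j₀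
        simp only [Pi.smul_apply, smul_eq_mul] at hc₀
        rw [hw₀, HahnSeries.coeff_zero] at hc₀
        have hc0 : c = 0 := by
          rcases mul_eq_zero.mp hc₀.symm with h | h
          · exact h
          · exact absurd h hj₀
        have hcj := congr_fun hc j
        simp only [Pi.smul_apply, smul_eq_mul, hc0, zero_mul] at hcj
        exact hj hcj
      · exact absurd hg hlt.ne
    by_cases hex₁ : ∃ i₁, μ + μ + o = -((N * b i₁ : ℕ) : ℤ)
    · obtain ⟨i₁, hi₁⟩ := hex₁
      refine ⟨fun j => (w j).coeff o, hv, i₁, fun i hi hii₁ => ?_⟩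
      rcases hcmp i hi with h | h
      · exact h
      · exfalso
        refine hii₁ (hb (Nat.eq_of_mul_eq_mul_left hN ?_))
        have h' : ((N * b i : ℕ) : ℤ) = ((N * b i₁ : ℕ) : ℤ) := neg_inj.mp (h.symm.trans hi₁)
        exact_mod_cast h'
    · refine ⟨fun j => (w j).coeff o, hv, τ, fun i hi _ => ?_⟩
      rcases hcmp i hi with h | h
      · exact h
      · exact absurd ⟨i, h⟩ hex₁
  · -- `o = -μ`: every `Γ_i(p)`, `i ≠ τ`, has order `≥ μ`, so `2 b_i ≤ b_τ` — impossible
    exfalso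
    obtain ⟨i, hi, hbi⟩ := hex
    have h1 := (InfinityCommonZero.le_and_eq_zero_or_eq (huv i) (hsol' i) (key i hi).1 rfl).1
    have h2 : N * b τ < 2 * (N * b i) := by
      have h := Nat.mul_lt_mul_of_pos_left hbi hN
      rwa [Nat.mul_left_comm] at h
    have h3 : ((N * b τ : ℕ) : ℤ) < 2 * ((N * b i : ℕ) : ℤ) := by exact_mod_cast h2
    omega

end Summit.ValiantsHypothesis.ValiantsHypothesis.Theorems.BinomialCandidateStubs
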